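import Summits.ResolutionOfSingularities.ResolutionOfSingularities.Theorems.WeightedInvariantIota3IsoSuccIsolated
import Summits.ResolutionOfSingularities.ResolutionOfSingularities.Theorems.WeightedInvariantKeyRungThreeOfDropPointStat
import Summits.ResolutionOfSingularities.ResolutionOfSingularities.Theorems.WeightedInvariantIota3DominanceWord
import Summits.ResolutionOfSingularities.ResolutionOfSingularities.Theorems.WeightedInvariantIota3SigmaPresentationOfDominance
import Summits.ResolutionOfSingularities.ResolutionOfSingularities.Theorems.WeightedInvariantIota3TwoFlagCompletion
import HarnessLib

/-!
# (D-b³-point-STAT), ISOLATED regime: order-stationary `t`-homogeneous successors are ISOLATED positions, for EVERY presentation `(u, w)` of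
# `J₃ᵗ` — and the refined gap list `keyRungGrHomLE_three_of_tieDescent_pointStatIso`
# (door `HypersurfaceCentreConstruction`, stmt-ResolutionOfSingularities-19897, stub `stub_keyRungGrHomLE_three`)

Topic: `Summits/ResolutionOfSingularities/ResolutionOfSingularities/Theorems`.  DEF-FREE.  Helper `--supports stmt-ResolutionOfSingularities-19897`.

Sequel of …KeyRungThreeOfDropPointStat (hand -11: gap list hD + (D-b³-point-STAT)) and of this hand's (iso-succ) PART C chain
(…IsoSuccHeightOne, …IsoSuccBelow, …IsoSuccLift, …IsoSuccNoStatCurve, …IsoSuccIsolated).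

* **`Iota3.pointStat_isolated`** — in the binders of (D-b³-point-STAT) (closed-point centre `P = 𝔪`, ANY minimal presentation `(u, w)` of
  `J₃ᵗ(S, f)`, a `t`-homogeneous successor `𝔫 ∋ t⁻¹` off the vertex, a saturated transform `g` ORDER-STATIONARY at `𝔫`) and in the ISOLATED
  regime (`IsIsolatedPosition S f`): **`(B_𝔫, g/1)` is an ISOLATED position** and the order of `g` is `< ν` at every prime strictly below `𝔫`.
  Transport: the tree's canonical σ-presentation at a dimension-3 `ε ≠ 1` point position (`sigmaMaximiserExistsLE3_of_atLevel`,
  `jSigmaCanonicalLE3_of_atLevel`, `jFlatT_eq_weightedMonomialIdeal_of_canonicalAt`, all on `twoFlagDominanceAtLevelLE3Body_holds`) presents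
  `J₃ᵗ = 𝒥((x, g₂, g₁); (q, r₂, r₁))` for a σ-maximiser; `weightedMonomialIdeal u w = 𝒥((x, g₂, g₁); (q, r₂, r₁))` as filtrations, and every object
  of the statement (`B`, `t⁻¹`, the vertex, `t`-homogeneity) depends on `(u, w)` only through the filtration, so …IsoSuccIsolated applies.
* **`keyRungGrHomLE_three_of_tieDescent_pointStatIso`** / **`_c11_pointStatIso`** — GAP LISTS: `KeyRungGrHomLE 3 p` ⟸ hD (resp. (c11)≤3) +
  **(D-b³-point-STAT-ISO)** — (D-b³-point-STAT) at ISOLATED starts WITH the successor's isolation and the order drop strictly below it GIVEN —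
  + **(D-b³-point-STAT-REST)** — (D-b³-point-STAT) at the non-isolated point starts (TIE `(ε,τ) = (0,1)`, CROSSING `(1,0)`), verbatim.

[OURS · L1 W4.3 · audit glue over this hand's kernel theorems; AI work, weaker than expert review; nothing here is a statement of the manuscript under
review (Hironaka 2017, [claim: Hironaka2017, status: under-review]).]

## References

* D. Abramovich, M. Temkin, J. Włodarczyk, *Functorial embedded resolution via weighted blowings up*, Algebra & Number Theory 18 (2024), §5. [AbramovichTemkinWlodarczyk2024]
* J. Włodarczyk, *Functorial resolution by torus actions*, arXiv:2203.03090, §2.3.9, §3.3. [Wlodarczyk2022]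
-/

noncomputable section

set_option linter.dupNamespace false -- mandated namespace of this single-conjunct summit

open IsLocalRing Literature.AlgebraicGeometry.Resolution
open Summit.ResolutionOfSingularities.ResolutionOfSingularities.Theorems
open Summit.ResolutionOfSingularities.ResolutionOfSingularities.Theorems.ContactCylinder

namespace Summit.ResolutionOfSingularities.ResolutionOfSingularities.Cruxes.HypersurfaceCentreConstruction.LocalEngine

namespace Iota3

/-- At an ISOLATED position of a regular local ring with `f ∈ 𝔪^ν ∖ 𝔪^{ν+1}`, the order drops at every non-maximal prime. [OURS · L1 W4.3] -/
theorem iotaOrd_localization_lt_of_isIsolatedPosition {S : Type} [CommRing S] [IsRegularLocalRing S] {f : S} {ν : ℕ}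
    (hfν : f ∈ maximalIdeal S ^ ν) (hfν1 : f ∉ maximalIdeal S ^ (ν + 1)) (hiso : IsIsolatedPosition S f)
    (𝔮₀ : Ideal S) [𝔮₀.IsPrime] (h𝔮₀ : 𝔮₀ ≠ maximalIdeal S) :
    iotaOrd (Localization.AtPrime 𝔮₀) (algebraMap S (Localization.AtPrime 𝔮₀) f) < ν := by
  have hν : iotaOrd S f = ν := (iotaOrd_eq_natCast_iff S f ν).mpr ⟨hfν, hfν1⟩
  have hle := iotaOrd_generizationMonotone S 𝔮₀ f
  rw [hν] at hle
  refine lt_of_le_of_ne hle fun h => h𝔮₀ ?_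
  have hmem : (⟨𝔮₀, ‹_›⟩ : PrimeSpectrum S) ∈ topStratum iotaOrd S f := by
    rw [ContactCylinder.mem_topStratum_iff, hν]
    exact h
  unfold IsIsolatedPosition at hiso
  rw [hiso] at hmem
  exact le_antisymm (IsLocalRing.le_maximalIdeal Ideal.IsPrime.ne_top') hmem

/-- **(D-b³-point-STAT), ISOLATED regime: the successor is ISOLATED, for every presentation of `J₃ᵗ`.**  In the binders of (D-b³-point-STAT)
(…KeyRungThreeOfDropPointStat) with `IsIsolatedPosition S f`: at a `t`-homogeneous successor `𝔫 ∋ t⁻¹` off the vertex where the saturated transform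
`g` is order-stationary (`g/1 ∈ 𝔪_𝔫^ν`, `ν = ord_S f`), `(B_𝔫, g/1)` is an ISOLATED position, and `ord_{B_𝔮}(g/1) < ν` at every prime `𝔮 < 𝔫`.
[OURS · L1 W4.3 · (iso-succ) PART C for the door] -/
theorem pointStat_isolated (p : ℕ) (k₀ : Type) [Field k₀] [CharP k₀ p] [PerfectField k₀]
    (S : Type) [CommRing S] [Algebra k₀ S] [Algebra.EssFiniteType k₀ S] [IsRegularLocalRing S]
    (f : S) (hd : ringKrullDim S = 3) (hf0 : f ≠ 0) (hf2 : f ∈ (maximalIdeal S) ^ 2)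
    (P : Ideal S) [P.IsPrime] (hE : topStratum iotaOrdEpsTau S f = {𝔮 | P ≤ 𝔮.asIdeal}) (hPm : P = maximalIdeal S)
    (hiso : IsIsolatedPosition S f)
    (n : ℕ) (u : Fin n → S) (w : Fin n → ℕ) (h5 : ∀ m : ℕ, weightedMonomialIdeal u w m = jFlatT S f m)
    (𝔫 : Ideal (cobordantAlgebra' u w)) [𝔫.IsPrime] (hhom : IsTHomogeneous u w 𝔫) (hT : cobordantT' u w ∈ 𝔫)
    (hV : ¬ extReesAlgebra.vertexIdeal (weightedMonomialIdeal u w) ≤ 𝔫)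
    (a : ℕ) (g : cobordantAlgebra' u w) (hfg : algebraMap S (cobordantAlgebra' u w) f = cobordantT' u w ^ a * g)
    (hTg : ¬ cobordantT' u w ∣ g)
    (ν : ℕ) (hfν : f ∈ maximalIdeal S ^ ν) (hfν1 : f ∉ maximalIdeal S ^ (ν + 1))
    (hgν : algebraMap (cobordantAlgebra' u w) (Localization.AtPrime 𝔫) g ∈ maximalIdeal (Localization.AtPrime 𝔫) ^ ν) :
    IsIsolatedPosition (Localization.AtPrime 𝔫) (algebraMap (cobordantAlgebra' u w) (Localization.AtPrime 𝔫) g) ∧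
      ∀ (𝔮 : Ideal (cobordantAlgebra' u w)) [𝔮.IsPrime], 𝔮 < 𝔫 →
        iotaOrd (Localization.AtPrime 𝔮) (algebraMap (cobordantAlgebra' u w) (Localization.AtPrime 𝔮) g) < ν := by
  subst hPm
  -- the position data
  have hν : 0 < ν := by
    by_contra hν0
    have hν0' : ν = 0 := by omega
    subst hν0'
    exact hfν1 (by rw [zero_add, pow_one]; exact Ideal.pow_le_self two_ne_zero hf2)
  have hfu : ¬ IsUnit f := (IsLocalRing.mem_maximalIdeal _).mp (Ideal.pow_le_self two_ne_zero hf2)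
  have htop : topStratumPrime iotaOrdEpsTau S f = maximalIdeal S := topStratumPrime_eq_maximalIdeal_of_topStratum_eq _ S f hE
  have hε' : iotaEps S f ≠ 1 := by rw [iotaEps_eq_zero_of_isIsolatedPosition hiso]; exact zero_ne_one
  have hdim' : ringKrullDim S = (3 : ℕ) := by rw [hd]; norm_cast
  have hd2 : ¬ ringKrullDim S ≤ 2 := by rw [hd]; decide
  have hadic : (adicOrder f).toNat = ν := adicOrder_toNat_eq_of_mem_of_not_mem hfν hfν1
  -- the canonical σ-presentation of `J₃ᵗ`
  obtain ⟨g₁, g₂, q, r₁, r₂, hmax, hprim⟩ :=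
    sigmaMaximiserExistsLE3_of_atLevel p (twoFlagDominanceAtLevelLE3Body_holds p) k₀ S f hdim' hf0 hf2 htop hε'
  obtain ⟨x, h𝔪, -⟩ := exists_span_triple_of_isTwoFlag S hdim' g₁ g₂ hmax.2.1
  have hcan := jSigmaCanonicalLE3_of_atLevel p (twoFlagDominanceAtLevelLE3Body_holds p) k₀ S f hdim' hf0 hf2 htop hε'
  have hJ : ∀ m, jFlatT S f m = weightedMonomialIdeal ![x, g₂, g₁] ![q, r₂, r₁] m := fun m =>
    jFlatT_eq_weightedMonomialIdeal_of_canonicalAt hf0 hfu htop hd2 hε' hcan hmax hprim h𝔪 m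
  have hI : weightedMonomialIdeal u w = weightedMonomialIdeal ![x, g₂, g₁] ![q, r₂, r₁] := funext fun m => (h5 m).trans (hJ m)
  rw [hadic] at hmax
  have hiso' : ∀ (𝔮₀ : Ideal S) [𝔮₀.IsPrime], 𝔮₀ ≠ maximalIdeal S →
      iotaOrd (Localization.AtPrime 𝔮₀) (algebraMap S (Localization.AtPrime 𝔮₀) f) < ν :=
    fun 𝔮₀ _ h𝔮₀ => iotaOrd_localization_lt_of_isIsolatedPosition hfν hfν1 hiso 𝔮₀ h𝔮₀
  exact ⟨isIsolatedPosition_transform_of_isSigmaMaximiser hd hν hmax hfν1 h𝔪 hiso' hI 𝔫 hT hhom hV a g hfg hTg hgν,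
    fun 𝔮 _ hlt => iotaOrd_lt_of_lt_of_isSigmaMaximiser hd hν hmax hfν1 h𝔪 hiso' hI 𝔫 hT hhom hV a g hfg hTg 𝔮 hlt⟩

/-- **(D-b³-point-STAT) ⟸ (D-b³-point-STAT-ISO) + (D-b³-point-STAT-REST)**: the ISOLATED regime is demanded only WITH the successor's
isolation (`IsIsolatedPosition (B_𝔫) (g/1)`) and the order drop strictly below `𝔫` SUPPLIED (`pointStat_isolated`); the other point regimes
(`¬ IsIsolatedPosition S f`: TIE / CROSSING) verbatim. [OURS · L1 W4.3 · audit glue] -/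
theorem pointStat_of_iso_rest (p : ℕ)
    (hISO : ∀ (k₀ : Type) [Field k₀] [CharP k₀ p] [PerfectField k₀]
      (S : Type) [CommRing S] [Algebra k₀ S] [Algebra.EssFiniteType k₀ S] [IsRegularLocalRing S]
      (f : S), ringKrullDim S = 3 → f ≠ 0 → f ∈ (maximalIdeal S) ^ 2 →
      ∀ (P : Ideal S) [P.IsPrime], IsRegularLocalRing (S ⧸ P) → f ∈ P →
        topStratum iotaOrdEpsTau S f = {𝔮 | P ≤ 𝔮.asIdeal} → ¬ ringKrullDim (Localization.AtPrime P) ≤ 1 →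
        P = maximalIdeal S → IsIsolatedPosition S f →
        ∀ (n : ℕ) (u : Fin n → S) (w : Fin n → ℕ),
          Ideal.span (Set.range u) = maximalIdeal S → (maximalIdeal S).spanFinrank = n → (∃ i, 0 < w i) →
          Ideal.span {x | ∃ i, 0 < w i ∧ x = u i} = P →
          (∀ m : ℕ, weightedMonomialIdeal u w m = jFlatT S f m) →
          ∀ (𝔫 : Ideal (cobordantAlgebra' u w)) [𝔫.IsPrime], IsTHomogeneous u w 𝔫 → cobordantT' u w ∈ 𝔫 →
            (maximalIdeal S).map (algebraMap S (cobordantAlgebra' u w)) ≤ 𝔫 →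
            ¬ extReesAlgebra.vertexIdeal (weightedMonomialIdeal u w) ≤ 𝔫 →
            ∀ (a : ℕ) (g : cobordantAlgebra' u w), algebraMap S (cobordantAlgebra' u w) f = cobordantT' u w ^ a * g →
              ¬ cobordantT' u w ∣ g →
              algebraMap (cobordantAlgebra' u w) (Localization.AtPrime 𝔫) g ∈ maximalIdeal (Localization.AtPrime 𝔫) ^ 2 →
              ∀ ν : ℕ, f ∈ maximalIdeal S ^ ν → f ∉ maximalIdeal S ^ (ν + 1) →
                algebraMap (cobordantAlgebra' u w) (Localization.AtPrime 𝔫) g ∈ maximalIdeal (Localization.AtPrime 𝔫) ^ ν →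
                -- SUPPLIED: the successor is isolated, and the order drops strictly below it
                IsIsolatedPosition (Localization.AtPrime 𝔫) (algebraMap (cobordantAlgebra' u w) (Localization.AtPrime 𝔫) g) →
                (∀ (𝔮 : Ideal (cobordantAlgebra' u w)) [𝔮.IsPrime], 𝔮 < 𝔫 →
                  iotaOrd (Localization.AtPrime 𝔮) (algebraMap (cobordantAlgebra' u w) (Localization.AtPrime 𝔮) g) < ν) →
              iotaFlatT (Localization.AtPrime 𝔫) (algebraMap (cobordantAlgebra' u w) (Localization.AtPrime 𝔫) g) <
                iotaFlatT S f)
    (hREST : ∀ (k₀ : Type) [Field k₀] [CharP k₀ p] [PerfectField k₀]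
      (S : Type) [CommRing S] [Algebra k₀ S] [Algebra.EssFiniteType k₀ S] [IsRegularLocalRing S]
      (f : S), ringKrullDim S = 3 → f ≠ 0 → f ∈ (maximalIdeal S) ^ 2 →
      ∀ (P : Ideal S) [P.IsPrime], IsRegularLocalRing (S ⧸ P) → f ∈ P →
        topStratum iotaOrdEpsTau S f = {𝔮 | P ≤ 𝔮.asIdeal} → ¬ ringKrullDim (Localization.AtPrime P) ≤ 1 →
        P = maximalIdeal S → ¬ IsIsolatedPosition S f →
        ∀ (n : ℕ) (u : Fin n → S) (w : Fin n → ℕ),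
          Ideal.span (Set.range u) = maximalIdeal S → (maximalIdeal S).spanFinrank = n → (∃ i, 0 < w i) →
          Ideal.span {x | ∃ i, 0 < w i ∧ x = u i} = P →
          (∀ m : ℕ, weightedMonomialIdeal u w m = jFlatT S f m) →
          ∀ (𝔫 : Ideal (cobordantAlgebra' u w)) [𝔫.IsPrime], IsTHomogeneous u w 𝔫 → cobordantT' u w ∈ 𝔫 →
            (maximalIdeal S).map (algebraMap S (cobordantAlgebra' u w)) ≤ 𝔫 →
            ¬ extReesAlgebra.vertexIdeal (weightedMonomialIdeal u w) ≤ 𝔫 →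
            ∀ (a : ℕ) (g : cobordantAlgebra' u w), algebraMap S (cobordantAlgebra' u w) f = cobordantT' u w ^ a * g →
              ¬ cobordantT' u w ∣ g →
              algebraMap (cobordantAlgebra' u w) (Localization.AtPrime 𝔫) g ∈ maximalIdeal (Localization.AtPrime 𝔫) ^ 2 →
              ∀ ν : ℕ, f ∈ maximalIdeal S ^ ν → f ∉ maximalIdeal S ^ (ν + 1) →
                algebraMap (cobordantAlgebra' u w) (Localization.AtPrime 𝔫) g ∈ maximalIdeal (Localization.AtPrime 𝔫) ^ ν →
              iotaFlatT (Localization.AtPrime 𝔫) (algebraMap (cobordantAlgebra' u w) (Localization.AtPrime 𝔫) g) <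
                iotaFlatT S f) :
    ∀ (k₀ : Type) [Field k₀] [CharP k₀ p] [PerfectField k₀]
      (S : Type) [CommRing S] [Algebra k₀ S] [Algebra.EssFiniteType k₀ S] [IsRegularLocalRing S]
      (f : S), ringKrullDim S = 3 → f ≠ 0 → f ∈ (maximalIdeal S) ^ 2 →
      ∀ (P : Ideal S) [P.IsPrime], IsRegularLocalRing (S ⧸ P) → f ∈ P →
        topStratum iotaOrdEpsTau S f = {𝔮 | P ≤ 𝔮.asIdeal} → ¬ ringKrullDim (Localization.AtPrime P) ≤ 1 →
        P = maximalIdeal S →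
        ∀ (n : ℕ) (u : Fin n → S) (w : Fin n → ℕ),
          Ideal.span (Set.range u) = maximalIdeal S → (maximalIdeal S).spanFinrank = n → (∃ i, 0 < w i) →
          Ideal.span {x | ∃ i, 0 < w i ∧ x = u i} = P →
          (∀ m : ℕ, weightedMonomialIdeal u w m = jFlatT S f m) →
          ∀ (𝔫 : Ideal (cobordantAlgebra' u w)) [𝔫.IsPrime], IsTHomogeneous u w 𝔫 → cobordantT' u w ∈ 𝔫 →
            (maximalIdeal S).map (algebraMap S (cobordantAlgebra' u w)) ≤ 𝔫 →
            ¬ extReesAlgebra.vertexIdeal (weightedMonomialIdeal u w) ≤ 𝔫 →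
            ∀ (a : ℕ) (g : cobordantAlgebra' u w), algebraMap S (cobordantAlgebra' u w) f = cobordantT' u w ^ a * g →
              ¬ cobordantT' u w ∣ g →
              algebraMap (cobordantAlgebra' u w) (Localization.AtPrime 𝔫) g ∈ maximalIdeal (Localization.AtPrime 𝔫) ^ 2 →
              ∀ ν : ℕ, f ∈ maximalIdeal S ^ ν → f ∉ maximalIdeal S ^ (ν + 1) →
                algebraMap (cobordantAlgebra' u w) (Localization.AtPrime 𝔫) g ∈ maximalIdeal (Localization.AtPrime 𝔫) ^ ν →
              iotaFlatT (Localization.AtPrime 𝔫) (algebraMap (cobordantAlgebra' u w) (Localization.AtPrime 𝔫) g) <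
                iotaFlatT S f := by
  intro k₀ _ _ _ S _ _ _ _ f hd hf0 hf2 P _ hreg hfP hE hP1 hPm n u w h1 h2 h3 h4 h5 𝔫 _ hhom hT hM hV a g hfg hTg hg2 ν hfν hfν1 hgν
  by_cases hiso : IsIsolatedPosition S f
  · obtain ⟨hisoB, hbelow⟩ := pointStat_isolated p k₀ S f hd hf0 hf2 P hE hPm hiso n u w h5 𝔫 hhom hT hV a g hfg hTg ν hfν hfν1 hgν
    exact hISO k₀ S f hd hf0 hf2 P hreg hfP hE hP1 hPm hiso n u w h1 h2 h3 h4 h5 𝔫 hhom hT hM hV a g hfg hTg hg2 ν hfν hfν1 hgν hisoB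
      (fun 𝔮 _ hlt => hbelow 𝔮 hlt)
  · exact hREST k₀ S f hd hf0 hf2 P hreg hfP hE hP1 hPm hiso n u w h1 h2 h3 h4 h5 𝔫 hhom hT hM hV a g hfg hTg hg2 ν hfν hfν1 hgν

/-- **GAP LIST for `stub_keyRungGrHomLE_three` — hD + (D-b³-point-STAT-ISO) + (D-b³-point-STAT-REST).** [OURS · L1 W4.3 · audit glue] -/
theorem keyRungGrHomLE_three_of_tieDescent_pointStatIso (p : ℕ)
    (hD : ∀ (T T' : Type) [CommRing T] [IsRegularLocalRing T] [CommRing T'] [IsRegularLocalRing T'] [Algebra T T']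
      [IsLocalHom (algebraMap T T')] [Algebra.FormallySmooth T T'] [Algebra.EssFiniteType T T'] (g : T),
      ringKrullDim T' ≤ 3 → IsTiePosition T' (algebraMap T T' g) → IsTiePosition T g)
    (hISO : ∀ (k₀ : Type) [Field k₀] [CharP k₀ p] [PerfectField k₀]
      (S : Type) [CommRing S] [Algebra k₀ S] [Algebra.EssFiniteType k₀ S] [IsRegularLocalRing S]
      (f : S), ringKrullDim S = 3 → f ≠ 0 → f ∈ (maximalIdeal S) ^ 2 →
      ∀ (P : Ideal S) [P.IsPrime], IsRegularLocalRing (S ⧸ P) → f ∈ P →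
        topStratum iotaOrdEpsTau S f = {𝔮 | P ≤ 𝔮.asIdeal} → ¬ ringKrullDim (Localization.AtPrime P) ≤ 1 →
        P = maximalIdeal S → IsIsolatedPosition S f →
        ∀ (n : ℕ) (u : Fin n → S) (w : Fin n → ℕ),
          Ideal.span (Set.range u) = maximalIdeal S → (maximalIdeal S).spanFinrank = n → (∃ i, 0 < w i) →
          Ideal.span {x | ∃ i, 0 < w i ∧ x = u i} = P →
          (∀ m : ℕ, weightedMonomialIdeal u w m = jFlatT S f m) →
          ∀ (𝔫 : Ideal (cobordantAlgebra' u w)) [𝔫.IsPrime], IsTHomogeneous u w 𝔫 → cobordantT' u w ∈ 𝔫 →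
            (maximalIdeal S).map (algebraMap S (cobordantAlgebra' u w)) ≤ 𝔫 →
            ¬ extReesAlgebra.vertexIdeal (weightedMonomialIdeal u w) ≤ 𝔫 →
            ∀ (a : ℕ) (g : cobordantAlgebra' u w), algebraMap S (cobordantAlgebra' u w) f = cobordantT' u w ^ a * g →
              ¬ cobordantT' u w ∣ g →
              algebraMap (cobordantAlgebra' u w) (Localization.AtPrime 𝔫) g ∈ maximalIdeal (Localization.AtPrime 𝔫) ^ 2 →
              ∀ ν : ℕ, f ∈ maximalIdeal S ^ ν → f ∉ maximalIdeal S ^ (ν + 1) →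
                algebraMap (cobordantAlgebra' u w) (Localization.AtPrime 𝔫) g ∈ maximalIdeal (Localization.AtPrime 𝔫) ^ ν →
                -- SUPPLIED: the successor is isolated, and the order drops strictly below it
                IsIsolatedPosition (Localization.AtPrime 𝔫) (algebraMap (cobordantAlgebra' u w) (Localization.AtPrime 𝔫) g) →
                (∀ (𝔮 : Ideal (cobordantAlgebra' u w)) [𝔮.IsPrime], 𝔮 < 𝔫 →
                  iotaOrd (Localization.AtPrime 𝔮) (algebraMap (cobordantAlgebra' u w) (Localization.AtPrime 𝔮) g) < ν) →
              iotaFlatT (Localization.AtPrime 𝔫) (algebraMap (cobordantAlgebra' u w) (Localization.AtPrime 𝔫) g) <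
                iotaFlatT S f)
    (hREST : ∀ (k₀ : Type) [Field k₀] [CharP k₀ p] [PerfectField k₀]
      (S : Type) [CommRing S] [Algebra k₀ S] [Algebra.EssFiniteType k₀ S] [IsRegularLocalRing S]
      (f : S), ringKrullDim S = 3 → f ≠ 0 → f ∈ (maximalIdeal S) ^ 2 →
      ∀ (P : Ideal S) [P.IsPrime], IsRegularLocalRing (S ⧸ P) → f ∈ P →
        topStratum iotaOrdEpsTau S f = {𝔮 | P ≤ 𝔮.asIdeal} → ¬ ringKrullDim (Localization.AtPrime P) ≤ 1 →
        P = maximalIdeal S → ¬ IsIsolatedPosition S f →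
        ∀ (n : ℕ) (u : Fin n → S) (w : Fin n → ℕ),
          Ideal.span (Set.range u) = maximalIdeal S → (maximalIdeal S).spanFinrank = n → (∃ i, 0 < w i) →
          Ideal.span {x | ∃ i, 0 < w i ∧ x = u i} = P →
          (∀ m : ℕ, weightedMonomialIdeal u w m = jFlatT S f m) →
          ∀ (𝔫 : Ideal (cobordantAlgebra' u w)) [𝔫.IsPrime], IsTHomogeneous u w 𝔫 → cobordantT' u w ∈ 𝔫 →
            (maximalIdeal S).map (algebraMap S (cobordantAlgebra' u w)) ≤ 𝔫 →
            ¬ extReesAlgebra.vertexIdeal (weightedMonomialIdeal u w) ≤ 𝔫 →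
            ∀ (a : ℕ) (g : cobordantAlgebra' u w), algebraMap S (cobordantAlgebra' u w) f = cobordantT' u w ^ a * g →
              ¬ cobordantT' u w ∣ g →
              algebraMap (cobordantAlgebra' u w) (Localization.AtPrime 𝔫) g ∈ maximalIdeal (Localization.AtPrime 𝔫) ^ 2 →
              ∀ ν : ℕ, f ∈ maximalIdeal S ^ ν → f ∉ maximalIdeal S ^ (ν + 1) →
                algebraMap (cobordantAlgebra' u w) (Localization.AtPrime 𝔫) g ∈ maximalIdeal (Localization.AtPrime 𝔫) ^ ν →
              iotaFlatT (Localization.AtPrime 𝔫) (algebraMap (cobordantAlgebra' u w) (Localization.AtPrime 𝔫) g) <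
                iotaFlatT S f) : KeyRungGrHomLE 3 p :=
  keyRungGrHomLE_three_of_tieDescent_pointStat p hD (pointStat_of_iso_rest p hISO hREST)

/-- **GAP LIST, (c11)-form — (c11)≤3 + (D-b³-point-STAT-ISO) + (D-b³-point-STAT-REST).** [OURS · L1 W4.3 · audit glue] -/
theorem keyRungGrHomLE_three_of_c11_pointStatIso (p : ℕ) (hc11 : IotaJEssSmoothCompatibleLE 3 iotaFlatT jFlatT)
    (hISO : ∀ (k₀ : Type) [Field k₀] [CharP k₀ p] [PerfectField k₀]
      (S : Type) [CommRing S] [Algebra k₀ S] [Algebra.EssFiniteType k₀ S] [IsRegularLocalRing S]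
      (f : S), ringKrullDim S = 3 → f ≠ 0 → f ∈ (maximalIdeal S) ^ 2 →
      ∀ (P : Ideal S) [P.IsPrime], IsRegularLocalRing (S ⧸ P) → f ∈ P →
        topStratum iotaOrdEpsTau S f = {𝔮 | P ≤ 𝔮.asIdeal} → ¬ ringKrullDim (Localization.AtPrime P) ≤ 1 →
        P = maximalIdeal S → IsIsolatedPosition S f →
        ∀ (n : ℕ) (u : Fin n → S) (w : Fin n → ℕ),
          Ideal.span (Set.range u) = maximalIdeal S → (maximalIdeal S).spanFinrank = n → (∃ i, 0 < w i) →
          Ideal.span {x | ∃ i, 0 < w i ∧ x = u i} = P →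
          (∀ m : ℕ, weightedMonomialIdeal u w m = jFlatT S f m) →
          ∀ (𝔫 : Ideal (cobordantAlgebra' u w)) [𝔫.IsPrime], IsTHomogeneous u w 𝔫 → cobordantT' u w ∈ 𝔫 →
            (maximalIdeal S).map (algebraMap S (cobordantAlgebra' u w)) ≤ 𝔫 →
            ¬ extReesAlgebra.vertexIdeal (weightedMonomialIdeal u w) ≤ 𝔫 →
            ∀ (a : ℕ) (g : cobordantAlgebra' u w), algebraMap S (cobordantAlgebra' u w) f = cobordantT' u w ^ a * g →
              ¬ cobordantT' u w ∣ g →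
              algebraMap (cobordantAlgebra' u w) (Localization.AtPrime 𝔫) g ∈ maximalIdeal (Localization.AtPrime 𝔫) ^ 2 →
              ∀ ν : ℕ, f ∈ maximalIdeal S ^ ν → f ∉ maximalIdeal S ^ (ν + 1) →
                algebraMap (cobordantAlgebra' u w) (Localization.AtPrime 𝔫) g ∈ maximalIdeal (Localization.AtPrime 𝔫) ^ ν →
                -- SUPPLIED: the successor is isolated, and the order drops strictly below it
                IsIsolatedPosition (Localization.AtPrime 𝔫) (algebraMap (cobordantAlgebra' u w) (Localization.AtPrime 𝔫) g) →
                (∀ (𝔮 : Ideal (cobordantAlgebra' u w)) [𝔮.IsPrime], 𝔮 < 𝔫 →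
                  iotaOrd (Localization.AtPrime 𝔮) (algebraMap (cobordantAlgebra' u w) (Localization.AtPrime 𝔮) g) < ν) →
              iotaFlatT (Localization.AtPrime 𝔫) (algebraMap (cobordantAlgebra' u w) (Localization.AtPrime 𝔫) g) <
                iotaFlatT S f)
    (hREST : ∀ (k₀ : Type) [Field k₀] [CharP k₀ p] [PerfectField k₀]
      (S : Type) [CommRing S] [Algebra k₀ S] [Algebra.EssFiniteType k₀ S] [IsRegularLocalRing S]
      (f : S), ringKrullDim S = 3 → f ≠ 0 → f ∈ (maximalIdeal S) ^ 2 →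
      ∀ (P : Ideal S) [P.IsPrime], IsRegularLocalRing (S ⧸ P) → f ∈ P →
        topStratum iotaOrdEpsTau S f = {𝔮 | P ≤ 𝔮.asIdeal} → ¬ ringKrullDim (Localization.AtPrime P) ≤ 1 →
        P = maximalIdeal S → ¬ IsIsolatedPosition S f →
        ∀ (n : ℕ) (u : Fin n → S) (w : Fin n → ℕ),
          Ideal.span (Set.range u) = maximalIdeal S → (maximalIdeal S).spanFinrank = n → (∃ i, 0 < w i) →
          Ideal.span {x | ∃ i, 0 < w i ∧ x = u i} = P →
          (∀ m : ℕ, weightedMonomialIdeal u w m = jFlatT S f m) →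
          ∀ (𝔫 : Ideal (cobordantAlgebra' u w)) [𝔫.IsPrime], IsTHomogeneous u w 𝔫 → cobordantT' u w ∈ 𝔫 →
            (maximalIdeal S).map (algebraMap S (cobordantAlgebra' u w)) ≤ 𝔫 →
            ¬ extReesAlgebra.vertexIdeal (weightedMonomialIdeal u w) ≤ 𝔫 →
            ∀ (a : ℕ) (g : cobordantAlgebra' u w), algebraMap S (cobordantAlgebra' u w) f = cobordantT' u w ^ a * g →
              ¬ cobordantT' u w ∣ g →
              algebraMap (cobordantAlgebra' u w) (Localization.AtPrime 𝔫) g ∈ maximalIdeal (Localization.AtPrime 𝔫) ^ 2 →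
              ∀ ν : ℕ, f ∈ maximalIdeal S ^ ν → f ∉ maximalIdeal S ^ (ν + 1) →
                algebraMap (cobordantAlgebra' u w) (Localization.AtPrime 𝔫) g ∈ maximalIdeal (Localization.AtPrime 𝔫) ^ ν →
              iotaFlatT (Localization.AtPrime 𝔫) (algebraMap (cobordantAlgebra' u w) (Localization.AtPrime 𝔫) g) <
                iotaFlatT S f) : KeyRungGrHomLE 3 p :=
  keyRungGrHomLE_three_of_c11_pointStat p hc11 (pointStat_of_iso_rest p hISO hREST)

end Iota3

end Summit.ResolutionOfSingularities.ResolutionOfSingularities.Cruxes.HypersurfaceCentreConstruction.LocalEngine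

end
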